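/-
Copyright (c) 2026 the pub-hodgecm-mathlib formalisation cell (harness21).  Prover seat hodgecm-mathlib-K2Liu-p26 (g0): Track B «K2-LIT»,
#184♮ = hLiu418 = stmt-HodgeConjecture-24832; #42S organ S1, (G) organ ROW (ρ-mid), brick [W2] of the (M2a-C2c) Cayley letter:
THE WEYL ELEMENT IS FRAME-INVARIANT (`PD · w_Δ · PD⁻¹ = w_Δ`), hence `frameSp_{PD}(ι′(w_Δ)) = ι(w_Δ)`.
-/
import Summits.HodgeConjecture.HodgeConjecture.Theorems.K2LiuLocalSWTensorBlockFrame        -- ★ (R-b) FILE 1: `adapt_matA_frameConj`, the doubled frame `PD = P ⊕ P`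
import Summits.HodgeConjecture.HodgeConjecture.Theorems.K2LiuLocalSWBigCellDecomposition    -- ★ `adapt_matA_weylDelta`
import HarnessLib

/-!
# Crux `HLiu418`, #42S organ S1, (G) organ ROW (ρ-mid), brick [W2]: THE WEYL ELEMENT `w_Δ` UNDER A DOUBLED RATIONAL FRAME

Cell `hodgecm-mathlib`, crux item hLiu418 = `stmt-HodgeConjecture-24832`, route of record `HCCMUnconditional`; squad K2 ∕ K2Liu, socket #42S (a), organ S1;
LEAD F0P6-plan (g14), desk K2Liu-p01 (g10).  THEOREMS ONLY (no `def`, no `instance`, no `notation`, no named-fact hypothesis, no `sorry`); lane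
`--supports stmt-HodgeConjecture-24832` (count-neutral helper).  Generic letters: `E/F` a quadratic extension of number fields with involution `c`, finite place
`v`, forms `T₀`, `T₀′` with a rational frame `Pᵀ T₀ P = T₀′` and its double `PD = P ⊕ P` (★ (R-b) FILE 1 `K2LiuLocalSWTensorBlockFrame` §1).

WHY (K2Liu-p26 (g0) road note 2026-09-04T16:48Z, bricks [W1]–[W4]).  The (G)-inert organ's witness `Φ_ε` is built (★ (H4) `K2LiuInertWitnessPackageOfMover`) on the
implementer `(E′_ε, Γ_ε) := (π, op)(frameMp_{PD} j̃(p₁, p₂))`; ★ (H4) wants the big-cell profile row `hprof` for it, which ★ F4a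
`K2LiuLocalSWBigCellFormula.exists_ne_zero_swSectionLoc_weylDelta_mul_nElem_eq_integral` supplies from the Cayley letter `E′_ε · ι(w_Δ) · E′_ε⁻¹ = J⁻¹ · m(B′)`.
Since `E′_ε = frameSp_{PD}(π(j̃))`, that letter is the frame transport of the block datum's one — PROVIDED the frame carries `ι′(w_Δ′)` to `ι(w_Δ)`.  THIS FILE:
* `frameConj_weylDelta` — **`PD · w_Δ^{T₀′} · PD⁻¹ = w_Δ^{T₀}`**: the adapted matrix of `w_Δ` is `[[0, 1], [1, 0]]` on both groups (★ `adapt_matA_weylDelta`) and the frame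
  conjugates adapted matrices by `diag(P_v, P_v)` (★ `adapt_matA_frameConj`), which commutes with `[[0, 1], [1, 0]]`;
* `frameSp_iota_weylDelta` — **`frameSp_{PD}(ι_{T₀′}(w_Δ)) = ι_{T₀}(w_Δ)`** (★ `iota_frameConj`).
Consumers: [W1] (`ι_{T₁⊕T₂}(w_Δ) = spInl ι₁(w_Δ) · spInr ι₂(w_Δ)`), [W3]∕[W4] (K2Liu-p23 (g0): `spInl`∕`spInr` and `frameSp` on `transportSp (J⁻¹ · m(B))`), then the
assembly (M2a-C2c) `K2LiuWitnessImplementerCayley` (this seat's successor) ⇒ `hprof` for `(E′_ε, Γ_ε)` ⇒ ★ (H4) ⇒ the middle profile row via ★∕📤 `K2LiuTensorMiddleCellHaarDelta` §2.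
References: [Kudla1994] §3; [MoeglinVignerasWaldspurger1987] Chap. 2 II Remarque (3); [Weil1964] n° 32; [PlatonovRapinchuk1994] §2.3.
HONEST LABEL.  Count-neutral helper; it retires nothing by itself: `HC_CM` is proved only modulo the 7 printed citations (2 remaining named inputs:
hLiu418 = `stmt-HodgeConjecture-24832`, h413 = `stmt-HodgeConjecture-24833`) until rung 0 closes.

## References
* [Kudla1994] S. S. Kudla, *Splitting metaplectic covers of dual reductive pairs*, Israel J. Math. 87 (1994), §3.
* [MoeglinVignerasWaldspurger1987] C. Mœglin, M.-F. Vignéras, J.-L. Waldspurger, LNM 1291 (1987), Chap. 2 II Remarque (3).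
* [Weil1964] A. Weil, *Sur certains groupes d'opérateurs unitaires*, Acta Math. 111 (1964), n° 32.
* [PlatonovRapinchuk1994] V. Platonov, A. Rapinchuk, *Algebraic Groups and Number Theory* (1994), §2.3.
-/

set_option autoImplicit false
set_option linter.dupNamespace false -- the mandated namespace repeats `HodgeConjecture.HodgeConjecture`

noncomputable section

open scoped Matrix
open NumberField IsDedekindDomain Matrix
open Literature.NumberTheory.Automorphic Literature.NumberTheory.Automorphic.UnitaryGroup
open Literature.NumberTheory.GelbartRogawski1991 Literature.NumberTheory.GelbartRogawski1991.GRConstruction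
open Literature.NumberTheory.GelbartRogawski1991.UnitaryDualPair
open Literature.NumberTheory.GelbartRogawski1991.UnitaryDualPair.LocalSplitting
open Literature.NumberTheory.GelbartRogawski1991.UnitaryDualPair.LocalSplitting.FrameTransport
open Literature.NumberTheory.GelbartRogawski1991.AdaptedBlocks
open Literature.NumberTheory.K2Lit.SiegelDoubled Literature.NumberTheory.K2Lit.LocalSiegelDoubled
open Summit.HodgeConjecture.HodgeConjecture.Cruxes.HLiu418.K2LiuLocalSWSectionDefs
open Summit.HodgeConjecture.HodgeConjecture.Cruxes.HLiu418.K2LiuLocalSWTensorBlockFrame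
open Summit.HodgeConjecture.HodgeConjecture.Cruxes.HLiu418.K2LiuLocalSWBigCellDecomposition

namespace Summit.HodgeConjecture.HodgeConjecture.Cruxes.HLiu418.K2LiuTensorFrameWeylDelta

variable (F : Type) [Field F] [NumberField F] (E : Type) [Field E] [NumberField E] [Algebra F E]
  (c : E ≃ₐ[F] E) (v : HeightOneSpectrum (𝓞 F)) (n : ℕ) {T₀ T₀' : Matrix (Fin n) (Fin n) F}
  {JD : Matrix (Fin (n + n)) (Fin (n + n)) E} (hJD : JD = (gramD F n T₀).map (algebraMap F E))
  {JD' : Matrix (Fin (n + n)) (Fin (n + n)) E} (hJD' : JD' = (gramD F n T₀').map (algebraMap F E))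
  (P : GL (Fin n) F) (hP : ((P : Matrix (Fin n) (Fin n) F))ᵀ * T₀ * (P : Matrix (Fin n) (Fin n) F) = T₀')
  {PD : GL (Fin (n + n)) F} (hPD : PD = UnitaryGroup.reindexGL (e₂ n) (UnitaryGroup.blockDiagGL (P, P)))

/-- **`PD · w_Δ^{T₀′} · PD⁻¹ = w_Δ^{T₀}`** — the Weyl element is frame-invariant (adapted matrix `[[0, 1], [1, 0]]` on both sides, conjugated by `diag(P_v, P_v)`).
[cite: Kudla1994, §3] [cite: MoeglinVignerasWaldspurger1987, Chap. 2 II Remarque (3)] [cite: Weil1964, n° 32] -/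
theorem frameConj_weylDelta :
    frameConj F E c v (n + n) hJD hJD' PD (transpose_pd_mul_gramD_mul_pd F n P hP hPD) (weylDelta F E c v n hJD' (T₀ := T₀')) =
      weylDelta F E c v n hJD (T₀ := T₀) := by
  have hQQ' : (P : Matrix (Fin n) (Fin n) F).map ((UnitaryGroup.toLocalRing E v).comp (algebraMap F (v.adicCompletion F))) *
      ((P⁻¹ : GL (Fin n) F) : Matrix (Fin n) (Fin n) F).map ((UnitaryGroup.toLocalRing E v).comp (algebraMap F (v.adicCompletion F))) = 1 := by
    rw [← Matrix.map_mul, ← Units.val_mul, mul_inv_cancel, Units.val_one, Matrix.map_one _ (map_zero _) (map_one _)]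
  apply matA_injective F E c v n
  apply eq_of_adapt_eq
  rw [adapt_matA_frameConj F E c v n hJD hJD' P hP hPD, adapt_matA_weylDelta, adapt_matA_weylDelta, Matrix.fromBlocks_multiply,
    Matrix.fromBlocks_multiply]
  simp only [Matrix.mul_zero, Matrix.zero_mul, add_zero, zero_add, Matrix.mul_one, hQQ']

variable [Algebra.IsQuadraticExtension F E] {δ : E} (hcδ : c δ = -δ) (hδ : δ ≠ 0) {d : F} (hd : δ * δ = algebraMap F E d)
  (hT₀ : T₀.IsSymm) (hT₀' : T₀'.IsSymm)

/-- **`frameSp_{PD}(ι_{T₀′}(w_Δ)) = ι_{T₀}(w_Δ)`** in `Sp(𝕎^𝔻_{T₀})` (★ `iota_frameConj` at `g′ = w_Δ`, and `frameConj_weylDelta`).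
[cite: MoeglinVignerasWaldspurger1987, Chap. 2 II Remarque (3)] [cite: Kudla1994, §3] -/
theorem frameSp_iota_weylDelta :
    frameSp F v (n + n) PD (transpose_pd_mul_gramD_mul_pd F n P hP hPD)
        (iota F E c (n + n) hcδ hδ hd (gramD F n T₀') (gramD_isSymm F n hT₀') hJD' v (weylDelta F E c v n hJD' (T₀ := T₀'))) =
      iota F E c (n + n) hcδ hδ hd (gramD F n T₀) (gramD_isSymm F n hT₀) hJD v (weylDelta F E c v n hJD (T₀ := T₀)) := by
  rw [← iota_frameConj F E c v (n + n) hJD hJD' PD (transpose_pd_mul_gramD_mul_pd F n P hP hPD) hcδ hδ hd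
    (gramD_isSymm F n hT₀) (gramD_isSymm F n hT₀'), frameConj_weylDelta F E c v n hJD hJD' P hP hPD]

end Summit.HodgeConjecture.HodgeConjecture.Cruxes.HLiu418.K2LiuTensorFrameWeylDelta

end
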